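import Literature.AnabelianGeometry.AbsoluteAnabelian.AbsTopIII.BiAnabelianCompatibilityTeleDelta
import Literature.AnabelianGeometry.AbsoluteAnabelian.AbsTopIII.BiAnabelianCompatibilityCores
import Literature.AnabelianGeometry.AbsoluteAnabelian.AbsTopIII.BiAnabelianNexusProofs

/-!
# [AbsTopIII] Cor. 3.7 (v) — the canonical shadow family `K'` has a translation-invariant boundary set

[cite: MochizukiAbsTopIII2015, Cor 3.7 (v) p.88]

abc-iut-L4-t5 (gen 6), groundwork for residual (R2) of HOME/staging/L4/L4-t5/DISCHARGE-PLAN-Cor37-compat.md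
§UPDATE gen 6 (the `Φ_m`-compatibility of the family `K'` realising `𝔗_δ` and `ℋ_δ`, second conjunct of
`ShiftCompatStmt′ θ`): the shadow data of abc-iut-L4-t12's pseudo-commuting shadow of `𝒟*` (`deltaShadow θ`:
shadow categories `𝒳`/`𝒩`/`𝔈`, shadow functors `𝟭`, `λ^×`, `λ^{×pf}`, `𝒩 → 𝔈`) are LITERALLY invariant under the
`ℤ`-translation of the first row, so the shadow functor of a translated path is (heterogeneously) the shadow functor
of the path (`shP_shift_heq`), and the boundary set "equal shadows" of the canonical family
`K' = (deltaShadow θ).shadowFamily (deltaFF θ)` is mapped bijectively onto itself by `Φ_Γ⃗ = shift m`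
(`shadowFamily_E_shift_iff`) — the boundary-set half of Def. 3.5 (v) compatibility of `Φ_m` with `K'`.  The
homotopy half (invariance of the universal homotopies, by uniqueness) is the remaining item (R2).  Proof-only;
model-level bookkeeping; nothing here bears on [IUTchIII] Cor. 3.12.
-/

set_option autoImplicit false

namespace Literature.AnabelianGeometry.AbsoluteAnabelian

open _root_.CategoryTheory _root_.Quiver

universe u

namespace AbsTopIII.BiAnabelianSetting

open DiagramOfCategories

variable {X E N : Type u} [Category.{u} X] [Category.{u} E] [Category.{u} N]
  (𝔖 : BiAnabelianSetting X E N) (θ : FiberSquare.BiAnabelianLift 𝔖.gal)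

/-- Composition with a fixed functor respects heterogeneous equality of functors out of equal (bundled)
categories. [folklore] -/
private theorem comp_heq_of_heq {A A' B C : Cat.{u, u}} (hA : A = A') {G : A ⥤ B} {G' : A' ⥤ B}
    (hG : HEq G G') (L : B ⥤ C) : HEq (G ⋙ L) (G' ⋙ L) := by
  subst hA
  rw [eq_of_heq hG]

/-- The shadow categories are translation-invariant. [cite: MochizukiAbsTopIII2015, Cor 3.7 (v) p.88] -/
theorem deltaSh_shiftObj (m : ℤ) (a : Cor37Vertex) :
    (𝔖.deltaShadow θ).Sh (Cor37Vertex.shiftObj m a) = (𝔖.deltaShadow θ).Sh a := by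
  cases a <;> rfl

/-- **The shadow functor of a translated path IS the shadow functor of the path** (heterogeneously; the shadow
functors of the edges do not see the row index). [cite: MochizukiAbsTopIII2015, Cor 3.7 (v) p.88] -/
theorem shP_shift_heq (m : ℤ) {a b : Cor37Vertex} (P : Path a b) :
    HEq ((𝔖.deltaShadow θ).shP ((Cor37Vertex.shift.{u, u} m).mapPath P)) ((𝔖.deltaShadow θ).shP P) := by
  induction P with
  | nil => cases a <;> exact HEq.rfl
  | cons P e ih =>
    cases e <;> exact comp_heq_of_heq (𝔖.deltaSh_shiftObj θ m a) ih _

/-- The boundary set of `K'` ("equal shadows") is stable under the translation.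
[cite: MochizukiAbsTopIII2015, Cor 3.7 (v) p.88] -/
theorem shadowFamily_E_shift (m : ℤ) {a b : Cor37Vertex} {P Q : Path a b}
    (h : ((𝔖.deltaShadow θ).shadowFamily (𝔖.deltaFF θ)).E P Q) :
    ((𝔖.deltaShadow θ).shadowFamily (𝔖.deltaFF θ)).E ((Cor37Vertex.shift.{u, u} m).mapPath P)
      ((Cor37Vertex.shift.{u, u} m).mapPath Q) := by
  change (𝔖.deltaShadow θ).shP P = (𝔖.deltaShadow θ).shP Q at h
  change (𝔖.deltaShadow θ).shP _ = (𝔖.deltaShadow θ).shP _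
  exact eq_of_heq (((𝔖.shP_shift_heq θ m P).trans (heq_of_eq h)).trans (𝔖.shP_shift_heq θ m Q).symm)

/-- **`Φ_Γ⃗ = shift m` induces a bijection of the boundary set of `K'` onto itself** (the boundary-set half of the
Def. 3.5 (v) compatibility of `Φ_m` with `K'`). [cite: MochizukiAbsTopIII2015, Cor 3.7 (v) p.88] -/
theorem shadowFamily_E_shift_iff (m : ℤ) {a b : Cor37Vertex} (P Q : Path a b) :
    ((𝔖.deltaShadow θ).shadowFamily (𝔖.deltaFF θ)).E P Q ↔
      ((𝔖.deltaShadow θ).shadowFamily (𝔖.deltaFF θ)).E ((Cor37Vertex.shift.{u, u} m).mapPath P)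
        ((Cor37Vertex.shift.{u, u} m).mapPath Q) :=
  HomotopyFamily.E_mapPath_iff_of_inverse (Cor37Vertex.shift_comp_neg m)
    ((𝔖.deltaShadow θ).shadowFamily (𝔖.deltaFF θ)).E (fun _ _ _ _ h => 𝔖.shadowFamily_E_shift θ m h)
    (fun _ _ _ _ h => 𝔖.shadowFamily_E_shift θ (-m) h) P Q

/-- The edge 2-cells of the shadow are translation-invariant as well (the only non-identity 2-cell, `θ^bi` over
`pr_⋎`, does not see the row index) — the datum for the homotopy half of (R2).
[cite: MochizukiAbsTopIII2015, Cor 3.7 (v) p.88] -/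
theorem deltaCan_shiftHom_heq (m : ℤ) {a b : Cor37Vertex} (e : a ⟶ b) :
    HEq ((𝔖.deltaShadow θ).can (Cor37Vertex.shiftHom m e)) ((𝔖.deltaShadow θ).can e) := by
  cases e <;> exact HEq.rfl

/-- ... and so are the augmentations. [cite: MochizukiAbsTopIII2015, Cor 3.7 (v) p.88] -/
theorem deltaAug_shiftObj_heq (m : ℤ) (a : Cor37Vertex) :
    HEq ((𝔖.deltaShadow θ).aug (Cor37Vertex.shiftObj m a)) ((𝔖.deltaShadow θ).aug a) := by
  cases a <;> exact HEq.rfl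

end AbsTopIII.BiAnabelianSetting

end Literature.AnabelianGeometry.AbsoluteAnabelian
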